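import Summits.ValiantsHypothesis.ValiantsHypothesis.Theorems.TwoAdicLadderPrecisionLadderLadderZTwoAdic
import Literature.Computability.AlgebraicComplexity.ValiantConjectureEquivProofs
import Literature.Computability.AlgebraicComplexity.RazElusiveGeneralProofs

/-!
# TwoAdicLadder — crux `PrecisionLadder` (stmt-ValiantsHypothesis-5948), line `birth`,
# registered stub `stub_ladderZ`: VH ⇒ stub, and VH ⟺ stub ∧ 2-adic integral normalisation
# (route-independent: this file imports no route file)

The registered open stub of `Cruxes/PrecisionLadder/Lines/birth.lean`,

  `stub_ladderZ : ∀ c, ∃ᶠ n in atTop, ∃ k, n ^ c < complexity (perPoly (Fin n) (ZMod (2 ^ (k + 1))))`,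

was relocated in `…LadderZTwoAdic.lean` as `¬ IsPComputable (per over ℤ_[2])`. Here:

* `complexity_perPoly_complex_le_of_zmod_pow` — the tree's complex transfer
  (`TwoAdicLadder.complexity_map_complex_le_of_twoAdic`, the engine of the route's support
  `LadderOfVH`, itself route-independent) specialised to the permanent and the rings `ℤ/2^(k+1)`:
  `(∀ k, L_{ℤ/2^(k+1)}(per_n) ≤ s) → L_ℂ(per_n) ≤ 21877 (n² + n + s + 2)²⁶`.
* `ladderZ_of_valiantsHypothesis` — **VH ⇒ stub** (refuting the stub refutes `VP ≠ VNP`), proved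
  WITHOUT the route file (so that this calibration stays outside the route's import cone): if the
  stub fails with exponent `c`, the transfer puts `per` in `VP_ℂ`, i.e. `VP_ℂ = VNP_ℂ`
  (`perNotPComputableComplex_iff_holds`).
* `not_isPComputable_perPoly_padicInt_of_valiantsHypothesis` — **VH ⇒ per ∉ VP_{ℤ₂}**.
* `valiantsHypothesis_iff_ladderZ_and_padicIntNormalisation` —
  **`VH ↔ stub ∧ (VP_ℂ = VNP_ℂ → per ∈ VP_{ℤ₂})`**: the stub's entire distance from the summit is
  `2`-adic integral normalisation of constants ("if `per` is easy over `ℂ` it is easy with `2`-adic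
  INTEGER constants" — this route's `TwoIntegralNormalisation` (division by `2`) and `stub_descent`
  (ramified / inert constants) in one statement, vacuous under VH).

* `ladderZ_of_not_isPComputable_padic`, `ladderZ_of_charZero_lower_bound` — **transfer of lower
  bounds**: `per ∉ VP_{ℚ₂}`, or a lower bound `n^c < L_K(per_n)` i.o. uniformly over all fields `K`
  of characteristic `0`, already gives the stub (the rungs of the stub are no harder than
  characteristic-zero field lower bounds, up to the universal circuit's polynomial loss).

Honest framing (rung currency): calibration of an OPEN stub; no rung is proved here; the stub
(`= per ∉ VP_{ℤ₂}`), the crux and `VP ≠ VNP` are NOT proved and nothing here is progress on them.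
No new definitions, no named facts, no sorry.

## References

* P. Bürgisser, *Completeness and Reduction in Algebraic Complexity Theory* (2000), §4.1 (the truth
  of `VP = VNP` over algebraically closed fields depends only on the characteristic; extension of
  scalars). [cite: Burgisser2000, §4.1]
-/

noncomputable section

open MvPolynomial

-- the summit and the problem share the name `ValiantsHypothesis` (D-0017 single-conjunct layout)
set_option linter.dupNamespace false

namespace Summit.ValiantsHypothesis.ValiantsHypothesis.Theorems.TwoAdicLadderPrecisionLadder

open Filter Literature.Computability.AlgebraicComplexity

/-- **Complex transfer for the permanent over the prime rings.** If `L_{ℤ/2^(k+1)}(per_n) ≤ s` for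
every `k`, then `L_ℂ(per_n) ≤ 21877 · (n² + n + s + 2)²⁶` (the tree's
`complexity_map_complex_le_of_twoAdic` with `R_k = ℤ/2^(k+1)`: `2` nilpotent, `2^k ≠ 0`; integer
permanent renamed to `Fin (n·n)` variables, `deg per_n = n`). [cite: Burgisser2000, §4.1] -/
theorem complexity_perPoly_complex_le_of_zmod_pow (n s : ℕ)
    (hc : ∀ k, complexity (perPoly (Fin n) (ZMod (2 ^ (k + 1)))) ≤ s) :
    complexity (perPoly (Fin n) ℂ) ≤ 21877 * (n * n + n + s + 2) ^ 26 := by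
  -- adapted from `TwoAdicLadder.complexity_perPoly_complex_le_of_twoAdic` (LadderOfVH), kept
  -- route-independent
  classical
  have h2 : ∀ k, IsNilpotent (2 : ZMod (2 ^ (k + 1))) := fun k => ⟨k + 1, by
    have h := ZMod.natCast_self (2 ^ (k + 1))
    push_cast at h
    exact h⟩
  have hk : ∀ k, (2 : ZMod (2 ^ (k + 1))) ^ k ≠ 0 := by
    intro k h
    have h' : ((2 ^ k : ℕ) : ZMod (2 ^ (k + 1))) = 0 := by push_cast; exact h
    rw [ZMod.natCast_eq_zero_iff] at h'
    have hlt : 2 ^ k < 2 ^ (k + 1) := Nat.pow_lt_pow_right (by norm_num) (by omega)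
    exact absurd (Nat.le_of_dvd (by positivity) h') (not_le.2 hlt)
  let e : Fin n × Fin n ≃ Fin (n * n) := finProdFinEquiv
  let f₀ : MvPolynomial (Fin (n * n)) ℤ := rename e (perPoly (Fin n) ℤ)
  have hmap : ∀ (B : Type) [CommRing B],
      MvPolynomial.map (Int.castRingHom B) f₀ = rename e (perPoly (Fin n) B) := by
    intro B _
    simp only [f₀, map_rename, map_perPoly]
  have hdeg : f₀.totalDegree ≤ n := by
    refine (totalDegree_rename_le _ _).trans ?_
    rw [totalDegree_perPoly_holds, Fintype.card_fin]
  have hcR : ∀ k, complexity (MvPolynomial.map (Int.castRingHom (ZMod (2 ^ (k + 1)))) f₀) ≤ s := by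
    intro k
    rw [hmap, complexity_rename_of_injective_holds e.injective]
    exact hc k
  have h := TwoAdicLadder.complexity_map_complex_le_of_twoAdic f₀ s (fun k => ZMod (2 ^ (k + 1)))
    h2 hk hcR
  rw [hmap, complexity_rename_of_injective_holds e.injective] at h
  clear_value f₀
  refine h.trans (Nat.mul_le_mul_left _ (Nat.pow_le_pow_left ?_ 26))
  omega

/-- **VH ⇒ stub** (so the stub cannot be refuted without refuting `VP ≠ VNP`), route-independently:
if the stub failed with exponent `c`, then for all large `n` and every `k`,
`L_{ℤ/2^(k+1)}(per_n) ≤ n^c`, whence `L_ℂ(per_n) ≤ 21877 (n² + n + n^c + 2)²⁶ ≤ n^(26c+119)`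
(`complexity_perPoly_complex_le_of_zmod_pow`, `pow_envelope`), the permanent would be
p-computable over `ℂ`, and `VP_ℂ = VNP_ℂ` (`perNotPComputableComplex_iff_holds`). Calibration
only; `VP ≠ VNP` is NOT proved here. [cite: Burgisser2000, §4.1] -/
theorem ladderZ_of_valiantsHypothesis (hVH : ValiantsHypothesis) :
    ∀ c : ℕ, ∃ᶠ n in atTop, ∃ k : ℕ,
      n ^ c < complexity (perPoly (Fin n) (ZMod (2 ^ (k + 1)))) := by
  have hper : ¬ IsPComputable (fun n => perPoly (Fin n) ℂ) :=
    perNotPComputableComplex_iff_holds.mpr hVH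
  rw [not_isPComputable_iff_frequently_lt] at hper
  intro c
  refine ((hper (26 * c + 119)).and_eventually (eventually_ge_atTop 2)).mono ?_
  rintro n ⟨hlt, hn⟩
  by_contra hk
  push Not at hk
  have hle := (complexity_perPoly_complex_le_of_zmod_pow n (n ^ c) hk).trans (pow_envelope c hn)
  exact absurd (hlt.trans_le hle) (lt_irrefl _)

/-- **VH ⇒ per ∉ VP_{ℤ₂}** (`ladderZ_of_valiantsHypothesis` through the relocation
`ladderZ_iff_not_isPComputable_padicInt`). Calibration only; `VP ≠ VNP` is NOT proved here.
[cite: Burgisser2000, §4.1] -/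
theorem not_isPComputable_perPoly_padicInt_of_valiantsHypothesis (hVH : ValiantsHypothesis) :
    ¬ IsPComputable (fun n => perPoly (Fin n) ℤ_[2]) :=
  ladderZ_iff_not_isPComputable_padicInt.1 (ladderZ_of_valiantsHypothesis hVH)

/-- **VH ⟺ stub ∧ `2`-adic integral normalisation.** The summit is equivalent to the registered
stub `stub_ladderZ` together with `VP_ℂ = VNP_ℂ → per ∈ VP_{ℤ₂}` ("if the permanent is easy over
`ℂ` then it is easy with `2`-adic INTEGER constants" — the conjunction of this route's
`TwoIntegralNormalisation` (division by `2`) and `stub_descent` (ramified/inert constants) in one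
statement, vacuous under VH). So the stub's entire distance from the summit is constant
normalisation, and the stub itself is the `ℤ₂`-hardness of the permanent. Calibration only:
neither conjunct nor `VP ≠ VNP` is proved here. [cite: Burgisser2000, §4.1] -/
theorem valiantsHypothesis_iff_ladderZ_and_padicIntNormalisation :
    ValiantsHypothesis ↔
      (∀ c : ℕ, ∃ᶠ n in atTop, ∃ k : ℕ,
          n ^ c < complexity (perPoly (Fin n) (ZMod (2 ^ (k + 1))))) ∧
        (VP ℂ = VNP ℂ → IsPComputable (fun n => perPoly (Fin n) ℤ_[2])) := by
  constructor
  · intro hVH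
    refine ⟨ladderZ_of_valiantsHypothesis hVH, fun hEq => ?_⟩
    have hne : VP ℂ ≠ VNP ℂ := hVH
    exact (hne hEq).elim
  · rintro ⟨hZ, hN⟩
    unfold ValiantsHypothesis Literature.PNP.ValiantHypothesis
    intro hEq
    exact ladderZ_iff_not_isPComputable_padicInt.1 hZ (hN hEq)

/-! ### Transfer of lower bounds: every characteristic-zero lower bound for `per` reaches the stub -/

/-- `L_{ℚ₂}(per_n) ≤ L_{ℤ₂}(per_n)` (extension of scalars along `ℤ₂ ⊂ ℚ₂`). [cite: Burgisser2000, §4.1] -/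
theorem complexity_perPoly_padic_le_padicInt (n : ℕ) :
    complexity (perPoly (Fin n) ℚ_[2]) ≤ complexity (perPoly (Fin n) ℤ_[2]) := by
  have hle := ArithCircuit.complexity_map_le (PadicInt.Coe.ringHom (p := 2)) (perPoly (Fin n) ℤ_[2])
  rwa [map_perPoly] at hle

/-- **Lower bounds over the FIELD `ℚ₂` transfer to the stub.** If for every `c` infinitely many `n`
have `n ^ c < L_{ℚ₂}(per_n)` (i.e. `per ∉ VP_{ℚ₂}`), then `stub_ladderZ` holds: `ℤ₂ ⊂ ℚ₂` and the
relocation `ladderZ_iff_not_isPComputable_padicInt`. (Any future circuit lower bound for the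
permanent proved over `ℚ₂` — a characteristic-zero field — lands on the ladder with polynomial
loss in the rung.) [cite: Burgisser2000, §4.1] -/
theorem ladderZ_of_not_isPComputable_padic
    (h : ¬ IsPComputable (fun n => perPoly (Fin n) ℚ_[2])) :
    ∀ c : ℕ, ∃ᶠ n in atTop, ∃ k : ℕ,
      n ^ c < complexity (perPoly (Fin n) (ZMod (2 ^ (k + 1)))) := by
  refine ladderZ_iff_not_isPComputable_padicInt.2 ?_
  rw [not_isPComputable_iff_frequently_lt] at h ⊢
  exact fun c => (h c).mono fun n hn => hn.trans_le (complexity_perPoly_padic_le_padicInt n)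

/-- **Uniform characteristic-zero lower bounds transfer to the stub.** If for every exponent `c`,
for infinitely many `n`, `n ^ c < L_K(per_n)` for EVERY field `K` of characteristic `0` (the form in
which circuit lower bounds are usually proved), then `stub_ladderZ` holds (instantiate `K := ℚ₂`).
So the rungs of the stub are not harder than field lower bounds in characteristic `0` — up to the
polynomial loss of the universal circuit. Honest framing: no such lower bound beyond input counting
is known; nothing is proved about the stub here. [cite: Burgisser2000, §4.1] -/
theorem ladderZ_of_charZero_lower_bound
    (h : ∀ c : ℕ, ∃ᶠ n in atTop, ∀ (K : Type) [Field K] [CharZero K],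
      n ^ c < complexity (perPoly (Fin n) K)) :
    ∀ c : ℕ, ∃ᶠ n in atTop, ∃ k : ℕ,
      n ^ c < complexity (perPoly (Fin n) (ZMod (2 ^ (k + 1)))) := by
  refine ladderZ_of_not_isPComputable_padic ?_
  rw [not_isPComputable_iff_frequently_lt]
  exact fun c => (h c).mono fun n hn => hn ℚ_[2]

end Summit.ValiantsHypothesis.ValiantsHypothesis.Theorems.TwoAdicLadderPrecisionLadder

end
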